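import Mathlib.MeasureTheory.Integral.MeanInequalities
import Mathlib.Analysis.SpecialFunctions.ImproperIntegrals
import Literature.Analysis.Complex.RectangleCauchyFormula
import Literature.NumberTheory.LFunctions.ZetaFractionalPartIntegral
import Literature.NumberTheory.LFunctions.GeneralizedRH
import Literature.NumberTheory.LFunctions.RHClassicalEquivalents
import HarnessLib

/-!
# The Nyman–Beurling–Báez-Duarte criterion on the critical line (Dirichlet-polynomial form)

This file decomposes the named fact `Literature.NumberTheory.LFunctions.baezDuarte_dirichlet_iff` (rh.S27, Mellin form;
`Literature/NumberTheory/LFunctions/RHClassicalEquivalents.lean`):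

  `RH ↔ ∀ ε > 0, ∃ A(s) = ∑_{n<N} a_n (n+1)^{-s}, ∫_ℝ |1 - ζ(1/2+it) A(1/2+it)|² dt/(1/4+t²) < ε`,

the image under the Mellin–Plancherel isometry of Báez-Duarte's Theorem 1.1 ("RH iff
`χ_(0,1] ∈ closure span{ρ(1/(ax)) : a ∈ ℕ}` in `L²(0,∞)`"; L. Báez-Duarte, Rend. Lincei (9) 14
(2003) 5–11 = arXiv:math/0202141). The function-space form `Literature.NumberTheory.LFunctions.baezDuarte_iff` is decomposed
in the sibling file `NymanBeurling.lean`; the two deep halves are equivalent through the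
Mellin–Plancherel theorem (Báez-Duarte–Balazard–Landreau–Saias, Adv. Math. 149 (2000), §1), which
Mathlib does not have yet, so both forms are kept.

## Contents

* `riemannHypothesis_of_dirichlet_approx` — the "if" half (approximation ⇒ RH), **PROVED**, by a
  contour-integral substitute for the Hardy-space argument: for a zero `ρ`, `1/2 < Re ρ < 1`, put
  `F(s) = (s - 1 - ζ₁(s)A(s)) (ρ+1) / ((s+1) s²)` (`ζ₁ = (s-1)ζ` entire, so `F` is holomorphic on
  `Re s > 0` and `F(ρ) = (ρ-1)/ρ² ≠ 0`); Cauchy's formula on `[1/2,T]×[-T,T]`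
  (`Literature.Analysis.Complex.integral_boundary_rect_div_sub_eq`) with the growth bound `ζ(s) = O(|s|)` on
  `Re s ≥ 1/2` (Titchmarsh (2.12.2), `Literature.NumberTheory.LFunctions.norm_riemannZeta₁_le_of_re_pos`) and `T → ∞` gives
  `2π|F(ρ)| ≤ ∫_ℝ |F(1/2+it)| / |1/2+it-ρ| dt` (`ofReal_norm_le_lintegral_line`); on the line
  `|s-1| = |s|`, so this is `≤ (∫|1-ζA|²/(1/4+t²))^{1/2} · C_ρ` by Cauchy–Schwarz, and `ε → 0` is
  absurd. Zeros with `Re ρ < 1/2` are excluded by `Literature.NumberTheory.LFunctions.quasiRiemannHypothesis_one_half_iff_holds`.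
* `baezDuarte_dirichlet_onlyIf` — the deep "only if" half (RH ⇒ approximation) as a NAMED FACT
  [BaezDuarte2003, Thm. 1.1, proof §2.2]; its printed inputs (Lemma 2.1 = Balazard–Saias, Lemma 2.2)
  are the named facts `baezDuarte_moebiusSum_approx`, `baezDuarte_zetaRatio_bound` of
  `NymanBeurling.lean` and are not restated here.
* `baezDuarte_dirichlet_iff_of_onlyIf` — assembly: `baezDuarte_dirichlet_onlyIf → baezDuarte_dirichlet_iff`.

## References

* L. Báez-Duarte, *A strengthening of the Nyman–Beurling criterion for the Riemann hypothesis*,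
  Atti Accad. Naz. Lincei Rend. Lincei (9) Mat. Appl. 14 (2003), 5–11 (arXiv:math/0202141),
  Thm. 1.1 and §2.2.
* A. Beurling, *A closure problem related to the Riemann zeta-function*, Proc. Nat. Acad. Sci. 41
  (1955), 312–314.
* L. Báez-Duarte, M. Balazard, B. Landreau, E. Saias, *Notes sur la fonction ζ de Riemann, 3*,
  Adv. Math. 149 (2000), 130–144, §1 (Mellin form of the distance `d_N`).
* E. C. Titchmarsh, *The Theory of the Riemann Zeta-Function*, 2nd ed. (1986), (2.12.2).
-/

noncomputable section

open Complex Set MeasureTheory Filter Topology intervalIntegral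
open scoped Real ENNReal

namespace Literature.NumberTheory.LFunctions

/-! ### Contour-integral control of point values by the critical line -/

/-- Far-side pointwise bound used in the contour argument: if `‖F s‖ ≤ C/‖s‖` for `Re s ≥ 1/2`,
`‖s‖ ≥ R₀`, then `‖F s / (s - ρ)‖ ≤ 2C/T²` whenever `‖s‖ ≥ T ≥ max(R₀, 2‖ρ‖, 1)`. [folklore] -/
lemma norm_div_sub_le_far {F : ℂ → ℂ} {ρ : ℂ} {C R₀ T : ℝ} (hC : 0 ≤ C)
    (hdecay : ∀ s : ℂ, 1 / 2 ≤ s.re → R₀ ≤ ‖s‖ → ‖F s‖ ≤ C / ‖s‖)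
    (hT₀ : R₀ ≤ T) (hT1 : 1 ≤ T) (hTρ : 2 * ‖ρ‖ ≤ T) {s : ℂ} (hs : 1 / 2 ≤ s.re) (hsT : T ≤ ‖s‖) :
    ‖F s / (s - ρ)‖ ≤ 2 * C / T ^ 2 := by
  have hT : 0 < T := by linarith
  have hs0 : 0 < ‖s‖ := by linarith
  have h1 : ‖F s‖ ≤ C / T :=
    (hdecay s hs (hT₀.trans hsT)).trans (div_le_div_of_nonneg_left hC hT hsT)
  have h2 : T / 2 ≤ ‖s - ρ‖ := by
    have := norm_sub_norm_le s ρ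
    have h' : ‖s‖ - ‖ρ‖ ≤ ‖s - ρ‖ := by
      have := norm_le_norm_add_norm_sub' s ρ
      linarith [norm_sub_rev s ρ]
    linarith
  rw [norm_div]
  calc ‖F s‖ / ‖s - ρ‖ ≤ (C / T) / (T / 2) := by gcongr
    _ = 2 * C / T ^ 2 := by field_simp

/-- **Point evaluation is controlled by the critical-line `L¹` mass** (the analytic core of the
"easy" half of the Nyman–Beurling criterion, done by contour integration instead of Hardy-space
theory). Let `F` be holomorphic on `Re s > 0` with `‖F(s)‖ ≤ C/‖s‖` for `Re s ≥ 1/2`, `‖s‖ ≥ R₀`, and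
let `Re ρ > 1/2`. Then `2π ‖F(ρ)‖ ≤ ∫_ℝ ‖F(1/2+it)/(1/2+it-ρ)‖ dt` (as a lower Lebesgue integral, so
no integrability hypothesis is needed). Proof: Cauchy's formula on `[1/2, T] × [-T, T]` and `T → ∞`;
the three far sides contribute `≤ 8C/T`. [folklore] -/
theorem ofReal_norm_le_lintegral_line {F : ℂ → ℂ} {ρ : ℂ} (hρ : 1 / 2 < ρ.re)
    (hF : DifferentiableOn ℂ F {s : ℂ | 0 < s.re}) {C R₀ : ℝ} (hC : 0 ≤ C)
    (hdecay : ∀ s : ℂ, 1 / 2 ≤ s.re → R₀ ≤ ‖s‖ → ‖F s‖ ≤ C / ‖s‖) :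
    ENNReal.ofReal (2 * π * ‖F ρ‖) ≤
      ∫⁻ t : ℝ, ‖F (1 / 2 + t * I) / (1 / 2 + t * I - ρ)‖ₑ := by
  set Λ := ∫⁻ t : ℝ, ‖F (1 / 2 + t * I) / (1 / 2 + t * I - ρ)‖ₑ with hΛ
  rcases eq_or_ne Λ ⊤ with htop | hfin
  · rw [htop]; exact le_top
  suffices h : 2 * π * ‖F ρ‖ ≤ Λ.toReal by
    calc ENNReal.ofReal (2 * π * ‖F ρ‖) ≤ ENNReal.ofReal Λ.toReal := ENNReal.ofReal_le_ofReal h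
      _ = Λ := ENNReal.ofReal_toReal hfin
  refine le_of_forall_pos_le_add fun ε hε ↦ ?_
  -- choice of the truncation height
  set T : ℝ := |R₀| + 1 + 2 * ‖ρ‖ + |ρ.im| + 8 * C / ε with hT
  have hCe : 0 ≤ 8 * C / ε := by positivity
  have hT₀ : R₀ ≤ T := by
    have := le_abs_self R₀
    linarith [norm_nonneg ρ, abs_nonneg ρ.im]
  have hT1 : 1 ≤ T := by linarith [norm_nonneg ρ, abs_nonneg ρ.im, abs_nonneg R₀]
  have hTρ : 2 * ‖ρ‖ ≤ T := by linarith [abs_nonneg ρ.im, abs_nonneg R₀]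
  have hTim : |ρ.im| < T := by linarith [norm_nonneg ρ, abs_nonneg R₀]
  have hTε : 8 * C / ε ≤ T := by linarith [norm_nonneg ρ, abs_nonneg ρ.im, abs_nonneg R₀]
  have hTpos : 0 < T := by linarith
  have hρpos : 0 < ‖ρ‖ := by
    have := abs_re_le_norm ρ
    have := le_abs_self ρ.re
    linarith
  -- ρ is interior to the rectangle [1/2, T] × [-T, T]
  have ha : (1 / 2 : ℝ) < ρ.re := hρ
  have hb : ρ.re < T := by
    have := abs_re_le_norm ρ
    have := le_abs_self ρ.re
    linarith
  have hc : -T < ρ.im := by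
    have := neg_abs_le ρ.im
    linarith
  have hd : ρ.im < T := lt_of_le_of_lt (le_abs_self _) hTim
  have hFR : DifferentiableOn ℂ F (Icc (1 / 2 : ℝ) T ×ℂ Icc (-T) T) := by
    refine hF.mono fun z hz ↦ ?_
    have : (1 / 2 : ℝ) ≤ z.re := hz.1.1
    show 0 < z.re
    linarith
  have hCIF := Literature.Analysis.Complex.integral_boundary_rect_div_sub_eq ρ ha hb hc hd hFR
  -- pointwise far-side bound
  have hfar : ∀ s : ℂ, 1 / 2 ≤ s.re → T ≤ ‖s‖ → ‖F s / (s - ρ)‖ ≤ 2 * C / T ^ 2 :=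
    fun s hs hsT ↦ norm_div_sub_le_far hC hdecay hT₀ hT1 hTρ hs hsT
  -- bottom side
  have hbot : ‖∫ x : ℝ in (1 / 2 : ℝ)..T, F ((x : ℂ) + ((-T : ℝ) : ℂ) * I) /
      ((x : ℂ) + ((-T : ℝ) : ℂ) * I - ρ)‖ ≤ 2 * C / T := by
    refine (intervalIntegral.norm_integral_le_of_norm_le_const (C := 2 * C / T ^ 2) fun x hx ↦ ?_).trans ?_
    · rw [uIoc_of_le (by linarith)] at hx
      refine hfar _ ?_ ?_
      · simp; linarith [hx.1]
      · refine le_trans ?_ (abs_im_le_norm _)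
        simp [abs_of_pos hTpos]
    · rw [abs_of_nonneg (by linarith)]
      calc 2 * C / T ^ 2 * (T - 1 / 2) ≤ 2 * C / T ^ 2 * T := by
            gcongr
            linarith
        _ = 2 * C / T := by field_simp
  -- top side
  have htop : ‖∫ x : ℝ in (1 / 2 : ℝ)..T, F ((x : ℂ) + (T : ℂ) * I) /
      ((x : ℂ) + (T : ℂ) * I - ρ)‖ ≤ 2 * C / T := by
    refine (intervalIntegral.norm_integral_le_of_norm_le_const (C := 2 * C / T ^ 2) fun x hx ↦ ?_).trans ?_
    · rw [uIoc_of_le (by linarith)] at hx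
      refine hfar _ ?_ ?_
      · simp; linarith [hx.1]
      · refine le_trans ?_ (abs_im_le_norm _)
        simp [abs_of_pos hTpos]
    · rw [abs_of_nonneg (by linarith)]
      calc 2 * C / T ^ 2 * (T - 1 / 2) ≤ 2 * C / T ^ 2 * T := by
            gcongr
            linarith
        _ = 2 * C / T := by field_simp
  -- right side
  have hright : ‖∫ y : ℝ in (-T)..T, F ((T : ℂ) + (y : ℂ) * I) /
      ((T : ℂ) + (y : ℂ) * I - ρ)‖ ≤ 4 * C / T := by
    refine (intervalIntegral.norm_integral_le_of_norm_le_const (C := 2 * C / T ^ 2) fun y _ ↦ ?_).trans ?_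
    · refine hfar _ ?_ ?_
      · simp; linarith
      · refine le_trans ?_ (abs_re_le_norm _)
        simp [abs_of_pos hTpos]
    · rw [show T - -T = 2 * T by ring, abs_of_nonneg (by linarith)]
      calc 2 * C / T ^ 2 * (2 * T) = 4 * C / T := by field_simp; ring
      _ ≤ 4 * C / T := le_rfl
  -- left side (critical line): bounded by the full-line lower integral
  have hhalf : ((1 / 2 : ℝ) : ℂ) = 1 / 2 := by push_cast; ring
  have hleft : ‖∫ y : ℝ in (-T)..T, F (((1 / 2 : ℝ) : ℂ) + (y : ℂ) * I) /
      (((1 / 2 : ℝ) : ℂ) + (y : ℂ) * I - ρ)‖ ≤ Λ.toReal := by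
    rw [hhalf, intervalIntegral.integral_of_le (by linarith)]
    refine (norm_integral_le_lintegral_norm _).trans ?_
    refine ENNReal.toReal_mono hfin ?_
    simp_rw [ofReal_norm]
    exact setLIntegral_le_lintegral _ _
  -- combine
  have hnorm : ‖2 * (Real.pi : ℂ) * I * F ρ‖ = 2 * π * ‖F ρ‖ := by
    simp [Real.pi_pos.le]
  set Bt := ∫ x : ℝ in (1 / 2 : ℝ)..T, F ((x : ℂ) + ((-T : ℝ) : ℂ) * I) /
      ((x : ℂ) + ((-T : ℝ) : ℂ) * I - ρ) with hBt
  set Tp := ∫ x : ℝ in (1 / 2 : ℝ)..T, F ((x : ℂ) + (T : ℂ) * I) /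
      ((x : ℂ) + (T : ℂ) * I - ρ) with hTp
  set Rt := ∫ y : ℝ in (-T)..T, F ((T : ℂ) + (y : ℂ) * I) /
      ((T : ℂ) + (y : ℂ) * I - ρ) with hRt
  set Lt := ∫ y : ℝ in (-T)..T, F (((1 / 2 : ℝ) : ℂ) + (y : ℂ) * I) /
      (((1 / 2 : ℝ) : ℂ) + (y : ℂ) * I - ρ) with hLt
  have htri : ‖Bt - Tp + I * Rt - I * Lt‖ ≤ ‖Bt‖ + ‖Tp‖ + ‖Rt‖ + ‖Lt‖ := by
    calc ‖Bt - Tp + I * Rt - I * Lt‖ ≤ ‖Bt - Tp + I * Rt‖ + ‖I * Lt‖ := norm_sub_le _ _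
      _ ≤ ‖Bt - Tp‖ + ‖I * Rt‖ + ‖I * Lt‖ := by gcongr; exact norm_add_le _ _
      _ ≤ ‖Bt‖ + ‖Tp‖ + ‖I * Rt‖ + ‖I * Lt‖ := by gcongr; exact norm_sub_le _ _
      _ = ‖Bt‖ + ‖Tp‖ + ‖Rt‖ + ‖Lt‖ := by simp
  have key : 2 * π * ‖F ρ‖ ≤ 2 * C / T + 2 * C / T + 4 * C / T + Λ.toReal := by
    rw [← hnorm, ← hCIF]
    linarith [hbot, htop, hright, hleft, htri]
  have h8 : 2 * C / T + 2 * C / T + 4 * C / T = 8 * C / T := by ring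
  have hεT : 8 * C / T ≤ ε := by
    rw [div_le_iff₀ hTpos]
    have := (div_le_iff₀ hε).mp hTε
    linarith
  linarith


/-! ### Dirichlet polynomials and the auxiliary function `F_{ρ,a}` -/

/-- The Dirichlet polynomial `A_a(s) = ∑_{n<N} a_n (n+1)^{-s}` (the route `NymanBeurling`
convention: coefficients indexed by `Fin N`, bases `1, …, N`). [folklore] -/
def dirichletPoly {N : ℕ} (a : Fin N → ℂ) (s : ℂ) : ℂ :=
  ∑ n : Fin N, a n * ((n : ℂ) + 1) ^ (-s)

/-- Unfolding lemma. [folklore] -/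
lemma dirichletPoly_apply {N : ℕ} (a : Fin N → ℂ) (s : ℂ) :
    dirichletPoly a s = ∑ n : Fin N, a n * ((n : ℂ) + 1) ^ (-s) := rfl

/-- `(n : ℂ) + 1 ≠ 0`. [folklore] -/
lemma natCast_add_one_ne_zero' (n : ℕ) : (n : ℂ) + 1 ≠ 0 := by
  exact_mod_cast Nat.succ_ne_zero n

/-- A Dirichlet polynomial is entire. [folklore] -/
lemma differentiable_dirichletPoly {N : ℕ} (a : Fin N → ℂ) :
    Differentiable ℂ (dirichletPoly a) := by
  unfold dirichletPoly
  refine Differentiable.fun_sum fun n _ ↦ ?_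
  refine (Differentiable.const_cpow differentiable_neg (Or.inl ?_)).const_mul _
  exact natCast_add_one_ne_zero' _

/-- A Dirichlet polynomial is continuous. [folklore] -/
lemma NymanBeurlingDirichlet.continuous_dirichletPoly {N : ℕ} (a : Fin N → ℂ) : Continuous (dirichletPoly a) :=
  (differentiable_dirichletPoly a).continuous

/-- `‖A_a(s)‖ ≤ ∑ ‖a_n‖` on the closed right half-plane. [folklore] -/
lemma norm_dirichletPoly_le {N : ℕ} (a : Fin N → ℂ) {s : ℂ} (hs : 0 ≤ s.re) :
    ‖dirichletPoly a s‖ ≤ ∑ n : Fin N, ‖a n‖ := by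
  unfold dirichletPoly
  refine (norm_sum_le _ _).trans (Finset.sum_le_sum fun n _ ↦ ?_)
  rw [norm_mul]
  have hbase : ((n : ℂ) + 1) = (((n : ℝ) + 1 : ℝ) : ℂ) := by push_cast; ring
  have hpos : (0 : ℝ) < (n : ℝ) + 1 := by positivity
  have : ‖((n : ℂ) + 1) ^ (-s)‖ ≤ 1 := by
    rw [hbase, norm_cpow_eq_rpow_re_of_pos hpos]
    refine Real.rpow_le_one_of_one_le_of_nonpos (by linarith) ?_
    simp; exact hs
  calc ‖a n‖ * ‖((n : ℂ) + 1) ^ (-s)‖ ≤ ‖a n‖ * 1 := by gcongr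
    _ = ‖a n‖ := mul_one _

/-- The auxiliary holomorphic function of the contour argument:
`F_{ρ,a}(s) = (s - 1 - ζ₁(s) A_a(s)) · ((ρ+1)/(s+1)) / s²`, where `ζ₁(s) = (s-1)ζ(s)` is Mathlib's
entire completion `riemannZeta₁`. Off `s = 1` it equals `(1 - ζ(s)A_a(s)) (s-1)(ρ+1)/((s+1)s²)`; on
the critical line `|s - 1| = |s|`, so `|F(s)| = |1 - ζA| · |ρ+1| / (|s+1| |s|)`. [folklore] -/
def nbAux (ρ : ℂ) {N : ℕ} (a : Fin N → ℂ) (s : ℂ) : ℂ :=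
  (s - 1 - riemannZeta₁ s * dirichletPoly a s) * ((ρ + 1) / (s + 1)) / s ^ 2

/-- `F_{ρ,a}` is holomorphic on `Re s > 0`. [folklore] -/
lemma differentiableOn_nbAux (ρ : ℂ) {N : ℕ} (a : Fin N → ℂ) :
    DifferentiableOn ℂ (nbAux ρ a) {s : ℂ | 0 < s.re} := by
  unfold nbAux
  have h1 : Differentiable ℂ fun s ↦ s - 1 - riemannZeta₁ s * dirichletPoly a s :=
    (differentiable_id.sub_const 1).sub
      (differentiable_riemannZeta₁.mul (differentiable_dirichletPoly a))
  refine DifferentiableOn.div ?_ (differentiableOn_id.pow 2) ?_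
  · refine h1.differentiableOn.mul ?_
    refine DifferentiableOn.div (differentiableOn_const _) (differentiableOn_id.add_const 1) ?_
    intro s hs h
    have : (s + 1).re = 0 := by rw [h]; simp
    simp at this
    have hs' : 0 < s.re := hs
    linarith
  · intro s hs h
    have hs' : 0 < s.re := hs
    have : s = 0 := pow_eq_zero_iff (n := 2) (by norm_num) |>.mp h
    rw [this] at hs'; simp at hs'

/-- At a zero `ρ` of `ζ` (with `ρ ≠ 1`, `ρ ≠ 0`, `ρ ≠ -1`), `F_{ρ,a}(ρ) = (ρ-1)/ρ²`, independently of
the Dirichlet polynomial. [folklore] -/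
lemma nbAux_apply_self {ρ : ℂ} (hζ : riemannZeta ρ = 0) (hρ1 : ρ ≠ 1) (hρm1 : ρ + 1 ≠ 0)
    {N : ℕ} (a : Fin N → ℂ) : nbAux ρ a ρ = (ρ - 1) / ρ ^ 2 := by
  have hz : riemannZeta₁ ρ = 0 := by
    have h := riemannZeta_eq_inv_sub_mul hρ1
    rw [hζ] at h
    have hne : (ρ - 1)⁻¹ ≠ 0 := inv_ne_zero (sub_ne_zero.mpr hρ1)
    exact (mul_eq_zero.mp h.symm).resolve_left hne
  unfold nbAux
  rw [hz, zero_mul, sub_zero, div_self hρm1, mul_one]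

/-- Growth of `F_{ρ,a}`: `‖F_{ρ,a}(s)‖ ≤ (2 + 5 ∑‖a_n‖) ‖ρ+1‖ / ‖s‖` for `Re s ≥ 1/2`, `‖s‖ ≥ 1`
(from Titchmarsh (2.12.2) in the form `‖ζ₁(s)‖ ≤ ‖s‖ + ‖s‖‖s-1‖/σ`). [folklore] -/
lemma norm_nbAux_le (ρ : ℂ) {N : ℕ} (a : Fin N → ℂ) {s : ℂ} (hs : 1 / 2 ≤ s.re) (h1 : 1 ≤ ‖s‖) :
    ‖nbAux ρ a s‖ ≤ (2 + 5 * ∑ n : Fin N, ‖a n‖) * ‖ρ + 1‖ / ‖s‖ := by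
  set M := ∑ n : Fin N, ‖a n‖ with hM
  have hM0 : 0 ≤ M := Finset.sum_nonneg fun n _ ↦ norm_nonneg _
  have hs0 : 0 < s.re := by linarith
  have hsn : 0 < ‖s‖ := by linarith
  -- ‖ζ₁ s‖ ≤ 5 ‖s‖²
  have hζ : ‖riemannZeta₁ s‖ ≤ 5 * ‖s‖ ^ 2 := by
    have h := norm_riemannZeta₁_le_of_re_pos hs0
    have hs1 : ‖s - 1‖ ≤ 2 * ‖s‖ := by
      calc ‖s - 1‖ ≤ ‖s‖ + ‖(1 : ℂ)‖ := norm_sub_le _ _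
        _ = ‖s‖ + 1 := by simp
        _ ≤ 2 * ‖s‖ := by linarith
    have hdiv : ‖s‖ * ‖s - 1‖ / s.re ≤ ‖s‖ * ‖s - 1‖ / (1 / 2) :=
      div_le_div_of_nonneg_left (by positivity) (by norm_num) hs
    calc ‖riemannZeta₁ s‖ ≤ ‖s‖ + ‖s‖ * ‖s - 1‖ / s.re := h
      _ ≤ ‖s‖ + ‖s‖ * ‖s - 1‖ / (1 / 2) := by linarith
      _ = ‖s‖ + 2 * (‖s‖ * ‖s - 1‖) := by ring
      _ ≤ ‖s‖ * ‖s‖ + 2 * (‖s‖ * (2 * ‖s‖)) := by gcongr; nlinarith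
      _ = 5 * ‖s‖ ^ 2 := by ring
  have hA : ‖dirichletPoly a s‖ ≤ M := norm_dirichletPoly_le a hs0.le
  have hnum : ‖s - 1 - riemannZeta₁ s * dirichletPoly a s‖ ≤ (2 + 5 * M) * ‖s‖ ^ 2 := by
    calc ‖s - 1 - riemannZeta₁ s * dirichletPoly a s‖
        ≤ ‖s - 1‖ + ‖riemannZeta₁ s * dirichletPoly a s‖ := norm_sub_le _ _
      _ ≤ (‖s‖ + 1) + ‖riemannZeta₁ s‖ * ‖dirichletPoly a s‖ := by
          rw [norm_mul]; gcongr
          calc ‖s - 1‖ ≤ ‖s‖ + ‖(1 : ℂ)‖ := norm_sub_le _ _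
            _ = ‖s‖ + 1 := by simp
      _ ≤ 2 * ‖s‖ ^ 2 + 5 * ‖s‖ ^ 2 * M := by
          gcongr ?_ + ?_
          · nlinarith
          · calc ‖riemannZeta₁ s‖ * ‖dirichletPoly a s‖ ≤ 5 * ‖s‖ ^ 2 * M := by gcongr
              _ = 5 * ‖s‖ ^ 2 * M := rfl
      _ = (2 + 5 * M) * ‖s‖ ^ 2 := by ring
  have hK : ‖(ρ + 1) / (s + 1)‖ ≤ ‖ρ + 1‖ / ‖s‖ := by
    rw [norm_div]
    refine div_le_div_of_nonneg_left (norm_nonneg _) hsn ?_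
    -- ‖s‖ ≤ ‖s + 1‖ since Re s ≥ 0
    have h2 : ‖s‖ ^ 2 ≤ ‖s + 1‖ ^ 2 := by
      rw [Complex.sq_norm, Complex.sq_norm, Complex.normSq_apply, Complex.normSq_apply]
      simp
      nlinarith
    exact le_of_pow_le_pow_left₀ two_ne_zero (norm_nonneg _) h2
  unfold nbAux
  rw [norm_div, norm_mul, norm_pow]
  calc ‖s - 1 - riemannZeta₁ s * dirichletPoly a s‖ * ‖(ρ + 1) / (s + 1)‖ / ‖s‖ ^ 2
      ≤ (2 + 5 * M) * ‖s‖ ^ 2 * (‖ρ + 1‖ / ‖s‖) / ‖s‖ ^ 2 := by gcongr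
    _ = (2 + 5 * M) * ‖ρ + 1‖ / ‖s‖ := by field_simp

/-! ### The critical line -/

/-- Points of the critical line, `s(t) = 1/2 + it`. [folklore] -/
lemma one_half_add_ne_one (t : ℝ) : (1 / 2 : ℂ) + t * I ≠ 1 := by
  intro h
  have := congrArg Complex.re h
  norm_num at this

/-- `‖1/2 + it‖² = 1/4 + t²`. [folklore] -/
lemma norm_sq_one_half_add (t : ℝ) : ‖(1 / 2 : ℂ) + t * I‖ ^ 2 = 1 / 4 + t ^ 2 := by
  rw [Complex.sq_norm, Complex.normSq_apply]
  simp; ring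

/-- `‖1/2 + it‖ > 0`. [folklore] -/
lemma norm_one_half_add_pos (t : ℝ) : 0 < ‖(1 / 2 : ℂ) + t * I‖ := by
  refine norm_pos_iff.mpr fun h ↦ ?_
  have := congrArg Complex.re h
  norm_num at this

/-- On the critical line `‖s - 1‖ = ‖s‖`. [folklore] -/
lemma norm_one_half_add_sub_one (t : ℝ) :
    ‖(1 / 2 : ℂ) + t * I - 1‖ = ‖(1 / 2 : ℂ) + t * I‖ := by
  have h1 : ‖(1 / 2 : ℂ) + t * I - 1‖ ^ 2 = 1 / 4 + t ^ 2 := by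
    rw [Complex.sq_norm, Complex.normSq_apply]
    simp; ring
  have h2 := norm_sq_one_half_add t
  exact (sq_eq_sq₀ (norm_nonneg _) (norm_nonneg _)).mp (h1.trans h2.symm)

/-- `t ↦ ζ(1/2 + it)` is continuous. [folklore] -/
lemma continuous_riemannZeta_line : Continuous fun t : ℝ ↦ riemannZeta (1 / 2 + t * I) := by
  have hc : Continuous fun t : ℝ ↦ (1 / 2 : ℂ) + t * I := by fun_prop
  refine continuous_iff_continuousAt.mpr fun t ↦ ?_
  exact ContinuousAt.comp (f := fun t : ℝ ↦ (1 / 2 : ℂ) + t * I)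
    (differentiableAt_riemannZeta (one_half_add_ne_one t)).continuousAt hc.continuousAt

/-- On the critical line, `‖F_{ρ,a}(s)/(s-ρ)‖ = (‖1 - ζ(s)A_a(s)‖/‖s‖) · ‖(ρ+1)/((s+1)(s-ρ))‖`.
[folklore] -/
lemma enorm_nbAux_div_line (ρ : ℂ) {N : ℕ} (a : Fin N → ℂ) (t : ℝ) :
    ‖nbAux ρ a (1 / 2 + t * I) / (1 / 2 + t * I - ρ)‖ₑ =
      ENNReal.ofReal (‖1 - riemannZeta (1 / 2 + t * I) * dirichletPoly a (1 / 2 + t * I)‖ /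
          ‖(1 / 2 : ℂ) + t * I‖) *
        ‖(ρ + 1) / ((1 / 2 : ℂ) + t * I + 1) / (1 / 2 + t * I - ρ)‖ₑ := by
  set s : ℂ := 1 / 2 + t * I with hs
  have hs1 : s ≠ 1 := one_half_add_ne_one t
  have hζ₁ : riemannZeta₁ s = (s - 1) * riemannZeta s := by
    rw [riemannZeta_eq_inv_sub_mul hs1]; field_simp [sub_ne_zero.mpr hs1]
  have hfac : nbAux ρ a s / (s - ρ) =
      ((s - 1) * (1 - riemannZeta s * dirichletPoly a s) / s ^ 2) *
        ((ρ + 1) / (s + 1) / (s - ρ)) := by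
    unfold nbAux; rw [hζ₁]; ring
  rw [hfac, enorm_mul, ← ofReal_norm]
  congr 1
  rw [norm_div, norm_mul, norm_pow, hs, norm_one_half_add_sub_one t, ← hs]
  have hpos : 0 < ‖s‖ := norm_one_half_add_pos t
  congr 1
  field_simp

/-- The kernel `‖(ρ+1)/((s+1)(s-ρ))‖²` has finite integral along the critical line when
`Re ρ > 1/2` (it is `≤ (‖ρ+1‖/(Re ρ - 1/2))² · (1+t²)⁻¹`). [folklore] -/
lemma lintegral_kernel_sq_lt_top {ρ : ℂ} (hρ : 1 / 2 < ρ.re) :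
    ∫⁻ t : ℝ, ‖(ρ + 1) / ((1 / 2 : ℂ) + t * I + 1) / (1 / 2 + t * I - ρ)‖ₑ ^ (2 : ℝ) < ⊤ := by
  set δ := ρ.re - 1 / 2 with hδ
  have hδ0 : 0 < δ := by linarith
  set M : ℝ := (‖ρ + 1‖ / δ) ^ 2 with hM
  have hbound : ∀ t : ℝ, ‖(ρ + 1) / ((1 / 2 : ℂ) + t * I + 1) / (1 / 2 + t * I - ρ)‖ ^ 2 ≤
      M * (1 + t ^ 2)⁻¹ := by
    intro t
    have h1 : 1 + t ^ 2 ≤ ‖(1 / 2 : ℂ) + t * I + 1‖ ^ 2 := by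
      rw [Complex.sq_norm, Complex.normSq_apply]; simp; nlinarith
    have h2 : δ ≤ ‖(1 / 2 : ℂ) + t * I - ρ‖ := by
      have := abs_re_le_norm ((1 / 2 : ℂ) + t * I - ρ)
      have hre : ((1 / 2 : ℂ) + t * I - ρ).re = 1 / 2 - ρ.re := by simp
      rw [hre, abs_sub_comm, abs_of_pos hδ0] at this
      exact this
    have h2' : δ ^ 2 ≤ ‖(1 / 2 : ℂ) + t * I - ρ‖ ^ 2 := pow_le_pow_left₀ hδ0.le h2 2
    have h1' : 0 < 1 + t ^ 2 := by positivity
    calc ‖(ρ + 1) / ((1 / 2 : ℂ) + t * I + 1) / (1 / 2 + t * I - ρ)‖ ^ 2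
        = ‖ρ + 1‖ ^ 2 / (‖(1 / 2 : ℂ) + t * I + 1‖ ^ 2 * ‖(1 / 2 : ℂ) + t * I - ρ‖ ^ 2) := by
          rw [norm_div, norm_div, div_pow, div_pow, div_div]
      _ ≤ ‖ρ + 1‖ ^ 2 / ((1 + t ^ 2) * δ ^ 2) := by
          refine div_le_div_of_nonneg_left (sq_nonneg _) (by positivity) ?_
          exact mul_le_mul h1 h2' (by positivity) (by positivity)
      _ = M * (1 + t ^ 2)⁻¹ := by
          rw [hM]
          field_simp
  have hint : Integrable fun t : ℝ ↦ M * (1 + t ^ 2)⁻¹ := integrable_inv_one_add_sq.const_mul M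
  calc ∫⁻ t : ℝ, ‖(ρ + 1) / ((1 / 2 : ℂ) + t * I + 1) / (1 / 2 + t * I - ρ)‖ₑ ^ (2 : ℝ)
      ≤ ∫⁻ t : ℝ, ENNReal.ofReal (M * (1 + t ^ 2)⁻¹) := by
        refine lintegral_mono fun t ↦ ?_
        rw [ENNReal.rpow_two, ← ofReal_norm, ← ENNReal.ofReal_pow (norm_nonneg _)]
        exact ENNReal.ofReal_le_ofReal (hbound t)
    _ = ENNReal.ofReal (∫ t : ℝ, M * (1 + t ^ 2)⁻¹) := by
        rw [ofReal_integral_eq_lintegral_ofReal hint]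
        exact Eventually.of_forall fun t ↦ by positivity
    _ < ⊤ := ENNReal.ofReal_lt_top

/-! ### The easy half of the Nyman–Beurling–Báez-Duarte criterion -/

/-- **Nyman–Beurling criterion, "if" part, Mellin/Dirichlet form** (Beurling 1955; the half that
Báez-Duarte 2003, §2.2 calls "clear"): if for every `ε > 0` some Dirichlet polynomial
`A(s) = ∑_{n<N} a_n (n+1)^{-s}` achieves `∫_ℝ |1 - ζ(1/2+it)A(1/2+it)|² dt/(1/4+t²) < ε`, then the
Riemann hypothesis holds. Proof (contour integration in place of Hardy-space theory): for a zero `ρ`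
with `1/2 < Re ρ < 1`, Cauchy's formula on `[1/2,T]×[-T,T]` for
`F(s) = (1 - ζ(s)A(s))(s-1)(ρ+1)/((s+1)s²)` and `T → ∞` (Titchmarsh (2.12.2) bounds the far sides)
give `2π|F(ρ)| ≤ ∫_ℝ |F(1/2+it)|/|1/2+it-ρ| dt ≤ ε^{1/2} · C_ρ` by Cauchy–Schwarz, while
`F(ρ) = (ρ-1)/ρ² ≠ 0`; zeros with `Re ρ < 1/2` are excluded by the functional equation
(`Literature.NumberTheory.LFunctions.quasiRiemannHypothesis_one_half_iff_holds`).
[cite: BaezDuarte2003, Thm. 1.1 ("if" part, §2.2)] [cite: Beurling1955, Theorem (easy half)] -/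
theorem riemannHypothesis_of_dirichlet_approx
    (hX : ∀ ε : ℝ, 0 < ε → ∃ (N : ℕ) (a : Fin N → ℂ),
      ∫⁻ t : ℝ, ENNReal.ofReal (‖1 - riemannZeta (1 / 2 + t * Complex.I) *
          ∑ n : Fin N, a n * ((n : ℂ) + 1) ^ (-(1 / 2 + t * Complex.I))‖ ^ 2 / (1 / 4 + t ^ 2)) <
        ENNReal.ofReal ε) :
    RiemannHypothesis := by
  refine Literature.NumberTheory.LFunctions.quasiRiemannHypothesis_one_half_iff_holds.mp fun ρ hζ hρ hρlt ↦ ?_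
  -- elementary facts about ρ
  have hρ1 : ρ ≠ 1 := by intro h; rw [h] at hρlt; simp at hρlt
  have hρ0 : ρ ≠ 0 := by intro h; rw [h] at hρ; simp at hρ; linarith
  have hρm1 : ρ + 1 ≠ 0 := by
    intro h
    have : (ρ + 1).re = 0 := by rw [h]; simp
    simp at this; linarith
  set v : ℝ := 2 * π * ‖(ρ - 1) / ρ ^ 2‖ with hv
  have hv0 : 0 < v := by
    have : 0 < ‖(ρ - 1) / ρ ^ 2‖ := norm_pos_iff.mpr (div_ne_zero (sub_ne_zero.mpr hρ1)
      (pow_ne_zero 2 hρ0))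
    positivity
  set G : ℝ≥0∞ := ∫⁻ t : ℝ, ‖(ρ + 1) / ((1 / 2 : ℂ) + t * I + 1) / (1 / 2 + t * I - ρ)‖ₑ ^ (2 : ℝ)
    with hG
  have hGfin : G < ⊤ := lintegral_kernel_sq_lt_top hρ
  have hg_meas : Measurable fun t : ℝ ↦
      ‖(ρ + 1) / ((1 / 2 : ℂ) + t * I + 1) / (1 / 2 + t * I - ρ)‖ₑ := by
    refine Measurable.enorm ?_
    exact (by fun_prop : Measurable fun t : ℝ ↦
      (ρ + 1) / ((1 / 2 : ℂ) + t * I + 1) / (1 / 2 + t * I - ρ))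
  -- the key inequality, for every ε > 0
  have key : ∀ ε : ℝ, 0 < ε → ENNReal.ofReal v ≤ ENNReal.ofReal ε ^ (1 / 2 : ℝ) * G ^ (1 / 2 : ℝ) := by
    intro ε hε
    obtain ⟨N, a, ha⟩ := hX ε hε
    set M := ∑ n : Fin N, ‖a n‖ with hM
    have hM0 : 0 ≤ M := Finset.sum_nonneg fun n _ ↦ norm_nonneg _
    have hC : 0 ≤ (2 + 5 * M) * ‖ρ + 1‖ := by positivity
    have hcore := ofReal_norm_le_lintegral_line (F := nbAux ρ a) hρ (differentiableOn_nbAux ρ a)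
      (R₀ := 1) hC (fun s hs h1 ↦ norm_nbAux_le ρ a hs h1)
    rw [nbAux_apply_self hζ hρ1 hρm1] at hcore
    refine hcore.trans ?_
    -- Cauchy–Schwarz on the critical line
    set f : ℝ → ℝ≥0∞ := fun t ↦ ENNReal.ofReal
      (‖1 - riemannZeta (1 / 2 + t * I) * dirichletPoly a (1 / 2 + t * I)‖ / ‖(1 / 2 : ℂ) + t * I‖)
      with hf
    set g : ℝ → ℝ≥0∞ := fun t ↦ ‖(ρ + 1) / ((1 / 2 : ℂ) + t * I + 1) / (1 / 2 + t * I - ρ)‖ₑ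
      with hg
    have hf_meas : Measurable f := by
      refine ENNReal.measurable_ofReal.comp ?_
      refine Measurable.div ?_ (by fun_prop)
      refine (Continuous.norm ?_).measurable
      have hc : Continuous fun t : ℝ ↦ (1 / 2 : ℂ) + t * I := by fun_prop
      exact continuous_const.sub (continuous_riemannZeta_line.mul
        ((NymanBeurlingDirichlet.continuous_dirichletPoly a).comp hc))
    calc ∫⁻ t : ℝ, ‖nbAux ρ a (1 / 2 + t * I) / (1 / 2 + t * I - ρ)‖ₑ
        = ∫⁻ t : ℝ, (f * g) t := lintegral_congr fun t ↦ enorm_nbAux_div_line ρ a t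
      _ ≤ (∫⁻ t, f t ^ (2 : ℝ)) ^ (1 / (2 : ℝ)) * (∫⁻ t, g t ^ (2 : ℝ)) ^ (1 / (2 : ℝ)) :=
          ENNReal.lintegral_mul_le_Lp_mul_Lq volume Real.HolderConjugate.two_two
            hf_meas.aemeasurable hg_meas.aemeasurable
      _ = (∫⁻ t : ℝ, ENNReal.ofReal (‖1 - riemannZeta (1 / 2 + t * Complex.I) *
            ∑ n : Fin N, a n * ((n : ℂ) + 1) ^ (-(1 / 2 + t * Complex.I))‖ ^ 2 /
              (1 / 4 + t ^ 2))) ^ (1 / 2 : ℝ) * G ^ (1 / 2 : ℝ) := by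
          congr 2
          refine lintegral_congr fun t ↦ ?_
          rw [hf]
          dsimp only
          rw [ENNReal.rpow_two, ← ENNReal.ofReal_pow (by positivity), div_pow,
            norm_sq_one_half_add t]
          rfl
      _ ≤ ENNReal.ofReal ε ^ (1 / 2 : ℝ) * G ^ (1 / 2 : ℝ) := by
          gcongr
  -- pass to real numbers and choose ε small
  have hGhalf : G ^ (1 / 2 : ℝ) ≠ ⊤ := ENNReal.rpow_ne_top_of_nonneg (by norm_num) hGfin.ne
  set g₀ : ℝ := (G ^ (1 / 2 : ℝ)).toReal with hg₀
  have hg₀0 : 0 ≤ g₀ := ENNReal.toReal_nonneg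
  have key' : ∀ ε : ℝ, 0 < ε → v ≤ Real.sqrt ε * g₀ := by
    intro ε hε
    have h := key ε hε
    rw [← ENNReal.ofReal_toReal hGhalf, ← hg₀,
      ENNReal.ofReal_rpow_of_nonneg hε.le (by norm_num), ← Real.sqrt_eq_rpow,
      ← ENNReal.ofReal_mul (Real.sqrt_nonneg _)] at h
    exact (ENNReal.ofReal_le_ofReal_iff (by positivity)).mp h
  set ε₀ : ℝ := (v / (2 * (g₀ + 1))) ^ 2 with hε₀
  have hq : 0 < v / (2 * (g₀ + 1)) := by positivity
  have h := key' ε₀ (by positivity)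
  rw [hε₀, Real.sqrt_sq hq.le] at h
  -- v ≤ v g₀ / (2(g₀+1)) < v
  have : v / (2 * (g₀ + 1)) * g₀ < v := by
    rw [div_mul_eq_mul_div, div_lt_iff₀ (by positivity)]
    nlinarith
  linarith


/-! ### The deep half (named fact) and assembly -/

/-- **The deep ("only if") half of the Nyman–Beurling–Báez-Duarte criterion, critical-line form**
NAMED FACT (Báez-Duarte 2003, Thm. 1.1, proof §2.2, read through the Mellin–Plancherel isometry
`M : L²(0,∞) → L²(Re s = 1/2, dt/2π)`, `M χ = 1/s`, `M ρ_a = -ζ(s)/(a^s s)`, eq. (2.9)–(2.10) of the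
paper): under RH, for every `ε > 0` some Dirichlet polynomial `A(s) = ∑_{n<N} a_n (n+1)^{-s}` has
`∫_ℝ |1 - ζ(1/2+it)A(1/2+it)|² dt/(1/4+t²) < ε`. Printed proof: `f_{ε,n} = ∑_{a≤n} μ(a)a^{-ε}ρ_a`,
Lemma 2.1 (`baezDuarte_moebiusSum_approx`), Lemma 2.2 (`baezDuarte_zetaRatio_bound`) and
RH ⇒ Lindelöf at abscissa `1/2 - ε` give the `L²(dt)` majorant `K_ε (1+|τ|)^{-1+2ε}` for
`M(x^{-ε} f_{2ε,n})`, hence `L²` convergence `f_{ε,n} → f_ε → -χ`. Equivalent to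
`baezDuarte_onlyIf` (function-space form, `NymanBeurling.lean`) granted Mellin–Plancherel. Users
take `(h : baezDuarte_dirichlet_onlyIf)`. [cite: BaezDuarte2003, Thm. 1.1 and §2.2] -/
def baezDuarte_dirichlet_onlyIf : Prop :=
  RiemannHypothesis →
    ∀ ε : ℝ, 0 < ε → ∃ (N : ℕ) (a : Fin N → ℂ),
      ∫⁻ t : ℝ, ENNReal.ofReal (‖1 - riemannZeta (1 / 2 + t * Complex.I) *
          ∑ n : Fin N, a n * ((n : ℂ) + 1) ^ (-(1 / 2 + t * Complex.I))‖ ^ 2 / (1 / 4 + t ^ 2)) <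
        ENNReal.ofReal ε

/-- **Assembly.** Báez-Duarte's Theorem 1.1 in critical-line form
(`Literature.NumberTheory.LFunctions.baezDuarte_dirichlet_iff`) follows from its deep half `baezDuarte_dirichlet_onlyIf`
(named fact) and the elementary half `riemannHypothesis_of_dirichlet_approx` (proved above).
[cite: BaezDuarte2003, Thm. 1.1] -/
theorem baezDuarte_dirichlet_iff_of_onlyIf (h : baezDuarte_dirichlet_onlyIf) :
    baezDuarte_dirichlet_iff :=
  ⟨h, riemannHypothesis_of_dirichlet_approx⟩

/-- The route item `NymanBeurling.Assembly` (stmt-RiemannHypothesis-0393) is literally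
`riemannHypothesis_of_dirichlet_approx` (`Summit.RiemannHypothesis` unfolds to
`RiemannHypothesis`); recorded here as the implication between the two right-hand sides for
provers to cite. [folklore] -/
theorem baezDuarte_dirichlet_iff_mpr :
    (∀ ε : ℝ, 0 < ε → ∃ (N : ℕ) (a : Fin N → ℂ),
      ∫⁻ t : ℝ, ENNReal.ofReal (‖1 - riemannZeta (1 / 2 + t * Complex.I) *
          ∑ n : Fin N, a n * ((n : ℂ) + 1) ^ (-(1 / 2 + t * Complex.I))‖ ^ 2 / (1 / 4 + t ^ 2)) <
        ENNReal.ofReal ε) → RiemannHypothesis :=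
  riemannHypothesis_of_dirichlet_approx

end Literature.NumberTheory.LFunctions

end
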